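import Literature.MathematicalPhysics.QuantumFieldTheory.Balaban1983to89.B9SectBStepUParGQOfMembers

/-!
# Balaban [B9], Thm 3.4 p. 400 ∕ Thm 3.3 p. 399 ∕ (3.15) p. 393 ∕ (3.80) p. 406 — THE K2-G DISPLAYED LAWS INHABITED AT THE STRAIGHT AVERAGING PAIR
# `(QY parB, QsY parB)`, AND ★★ THE SUBSUMPTION `sectBStepUParG_of_members` ⇐ `sectBStepUParGQ_of_members` AS AN `example` (CASCADE-K piece «K2-G», instance check)

T. Bałaban, *Propagators for lattice gauge theories in a background field*, Commun. Math. Phys. **99** (1985) 389–434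
[`Balaban1985BackgroundPropagators`, "B9"]; [4] = [`Balaban1984PropagatorsII`]; [B8] = [`Balaban1985Averaging`].

statement-level skeleton of published theorems with citation tags; proofs where landed; nothing here is a claim about the Yang–Mills mass gap

WHY THIS FILE (seat dag-n06-c gen 25; «⚑ K2-G SCOPE», node00-def-Y RULING I.20106 owner condition (a)).  The K2-G constructors ∕ junction display the averaging
pair's (3.15) ∕ (3.80) size laws `hQ15 hQ80 hQL2 hQL280` (sup-exp and block-ℓ² majorants of `QbQC ∕ QsbQC ∕ F₂QC ∕ F₂sQC (2)`), guarded like `hparG ∕ hunitA`.  §1 inhabits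
the four laws at `(𝔮, 𝔮s) := (QY parB, QsY parB)` with explicit constants from `B9SectBQSizesY` ∕ `B9SectBQVariationY` ∕ `B9SectBQLettersL2Y` (the proofs that module S2∕S3
carried inside their `hQb ∕ hQsb ∕ hF₂ ∕ hQb2 ∕ hQsb2 ∕ hF₂2` fields), read through the `rfl` faces of `B9SectBGWordDeltaAQY` §4 ∕ `B9SectBQLettersL2QY` §3; §2 ★★ an
`example`: S5's `sectBStepUParG_of_members` STATEMENT VERBATIM obtained from `sectBStepUParGQ_of_members` — the K2 subsumption, kernel-checked in the tree.

HONEST SCOPE.  Bookkeeping: an instance check of the generic-pair road against the landed straight road; nothing of [B9] asserted; count-neutral; N06 NOT discharged;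
K1⁹ NOT closed; nothing continuum ∕ OS ∕ mass-gap ∕ Clay.  0 `def`, 0 `sorry`.  `--supports stmt-QuantumFields-27364`.

RELATED IN THE TREE, NOT DUPLICATED: `B9SectBStepUParGOfMembers` (S5: the straight junction, NOT re-proved — re-DERIVED under a new name as a check),
`B9SectBStepUParGQOfMembers` (K2-G stage D), `B9SectBQSizesY ∕ B9SectBQVariationY ∕ B9SectBQLettersL2Y` (the straight size lemmas, USED).
-/

noncomputable section

namespace Literature.MathematicalPhysics.QuantumFieldTheory.Balaban1983to89.B9SectBQLawsStraightY

open Literature.MathematicalPhysics.QuantumFieldTheory.Balaban1983to89.B9SectBCodedClassR (RegExtraY bg9YC)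
open B6Ineq2142KLevelV1 (β)
open B6RandomWalk (HasMajorant hasMajorant_mono Ineq261)
open B6RandomWalkL2 (HasL2Majorant hasL2Majorant_mono)
open B9Thm34Ext (toB6)
open B9PinMembersKLevelV1 (MemberY geo9Y bg9Y)
open B9GeoNormsKLevelV1 (geo9K)
open B9Eq360DeltaPrimeAY (AfldY)
open B9SectBGpLettersY (GVal blkC)
open B9SectBGpFrameCodedYR (codingYx)
open B9SectBGpFrameCodedY (CplxLettersY)
open B9SectBCodedReadingsUR (KACU)
open B9SectBCodedReadingsUParH (KSCUPar SectBStepUPar)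
open B9SectBKerFrameCodedYR (CinvY)
open B9SectBGClassLettersY (Reg335PlaqY CplxLettersGY VarParBY)
open B9SectBGFrameCodedY (parB_contractive)
open B9Eq340HolderLipParBY (hparB_parBY)
open B9Eq340TaxiContourLocalityY (rLB)
open B9SectBL2SecondOrderY (PlaqLawY)
open B9SectBH1ProbesY (HolderLipY)
open B9RWSumsReadsNbr (nbr)
open B9SectBQSizesY (hasMajorant_QbC hasMajorant_QsbC)
open B9SectBQVariationY (hasMajorant_F₂C hasMajorant_F₂sC)
open B9SectBQLettersL2Y (hasL2Majorant_QbC2 hasL2Majorant_QsbC2 hasL2Majorant_F₂C2 hasL2Majorant_F₂sC2)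
open B9SectBGWordDeltaAQY (QbQC QsbQC F₂QC F₂sQC QbQC_QY QsbQC_QsY F₂QC_QY F₂sQC_QsY)
open B9SectBQLettersL2QY (QbQC2 QsbQC2 F₂QC2 F₂sQC2 QbQC2_QY QsbQC2_QsY F₂QC2_QY F₂sQC2_QsY)
open B9SectBGFramesSelQY (gFrame₅CodedOnSelQ)
open B9SectBGFramesSelY (gFrame₅CodedOnSel)
open B9SectBStepUParGQOfMembers (sectBStepUParGQ_of_members)
open Node00 (SiteY BlkY FBondY IBondY CfgY SiteParY BondParY BondOpY GAY GAQY GpY XY deltaAY deltaAQY deltaPrimeAY parBY QY QsY kernelFamilyS kernelFamilyB)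

variable {d ℓ : ℕ} {hd : 1 ≤ d + 1} {hL : Odd (ℓ + 1) ∧ 1 < ℓ + 1} {b₀ b₁ : ℝ} {Mstar : ℕ}
variable {𝔸 : Type} [NormedRing 𝔸] (P : RegExtraY d ℓ hd hL b₀ b₁ Mstar 𝔸) [NormedAlgebra ℂ 𝔸] [CompleteSpace 𝔸] [NormOneClass 𝔸] [FiniteDimensional ℝ 𝔸]
  {J : Type} (f : J → MemberY d ℓ hd hL b₀ b₁ Mstar) [∀ x : MemberY d ℓ hd hL b₀ b₁ Mstar, Fintype (geo9Y x).Site]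
  [instDS : ∀ x : MemberY d ℓ hd hL b₀ b₁ Mstar, DecidableEq (geo9Y x).Site] [instNE : ∀ x : MemberY d ℓ hd hL b₀ b₁ Mstar, Nonempty (geo9Y x).Site]
  (c35 : ℝ) (G : Subgroup 𝔸ˣ) (parB : ∀ j : J, BondParY 𝔸 (f j).toKIdx)
  {ι : Type} [Fintype ι] [DecidableEq ι] (b : Module.Basis ι ℝ 𝔸)
  (ιB : ∀ j : J, BlkY (f j).toKIdx → IBondY (f j).toKIdx)
  (C37 : ∀ j : J, ℝ → CfgY 𝔸 (f j).toKIdx → AfldY 𝔸 (f j).toKIdx → Prop)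

/-! ## §1 The displayed laws of the K2-G constructors INHABITED at the straight pair `(QY parB, QsY parB)` -/

omit [NormOneClass 𝔸] [FiniteDimensional ℝ 𝔸] instDS instNE [DecidableEq ι] in
/-- ★ **(L1) AT THE STRAIGHT PAIR**: the (3.15) block majorants `hQ15` of `gFrame₅CodedOnSelQ` hold at `(𝔮, 𝔮s) := (QY parB, QsY parB)` with the constant
`κQ := (M₂Σ‖b_j‖)·2L^{d+1}·e^{ℓ+3}` — `B9SectBQSizesY.hasMajorant_QbC ∕ hasMajorant_QsbC` (rows of the averaging kernel, contractive `G`-valued bond transporters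
`hparB`) read through the `rfl` faces `QbQC_QY ∕ QsbQC_QsY`; the (3.35) guard is not used (the straight letter is a transport-lift of a flat kernel).
[cite: Balaban1985BackgroundPropagators, (3.15) p.393, (3.12)–(3.13) p.392; Balaban1984PropagatorsII, (2.51) p.232] -/
theorem hQ15_straight (hι : ∀ (j : J) (s : BlkY (f j).toKIdx), β (f j).toKIdx.hN (f j).toKIdx.D (f j).toKIdx.hk (ιB j s) = s)
    (hG1 : ∀ u : 𝔸ˣ, u ∈ G → ‖(u : 𝔸)‖ ≤ 1) {M₂ : ℝ} (hM₂ : 0 ≤ M₂) (hrepr : ∀ (v : 𝔸) (j : ι), |b.repr v j| ≤ M₂ * ‖v‖) (hcR : 0 < M₂ * ∑ j, ‖b j‖)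
    (hparB : ∀ j (U : CfgY 𝔸 (f j).toKIdx), GVal G (f j).toKIdx U → ∀ y f', parB j U y f' ∈ G) (MInv aInv : ℝ) :
    ∀ j (α₀ : ℝ) (U : CfgY 𝔸 (f j).toKIdx) (δ : ℝ), MInv ≤ (geo9Y (f j)).M → 0 < α₀ → (geo9Y (f j)).M * α₀ ≤ aInv →
      (bg9YC 𝔸 G P (f j)).Reg335 c35 α₀ U → 0 < δ → δ ≤ 1 →
      HasMajorant (g := toB6 (geo9Y (f j)) 0 True) (fun q : (Fin (d + 1) × SiteY (f j).toKIdx) × ι => blkC (f j).toKIdx (ιB j) q.1.2)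
          (QbQC (f j).toKIdx (QY (f j).toKIdx (parB j)) b (.base U)) (fun a a' => ((M₂ * ∑ j, ‖b j‖) * (2 * (((ℓ + 1 : ℕ) : ℝ)) ^ (d + 1)) * Real.exp (1 * ((ℓ : ℝ) + 3))) * Real.exp (-(δ * (geo9Y (f j)).dist a a'))) ∧
        HasMajorant (g := toB6 (geo9Y (f j)) 0 True) (fun q : (Fin (d + 1) × SiteY (f j).toKIdx) × ι => blkC (f j).toKIdx (ιB j) q.1.2)
          (QsbQC (f j).toKIdx (QsY (f j).toKIdx (parB j)) b (.base U)) (fun a a' => ((M₂ * ∑ j, ‖b j‖) * (2 * (((ℓ + 1 : ℕ) : ℝ)) ^ (d + 1)) * Real.exp (1 * ((ℓ : ℝ) + 3))) * Real.exp (-(δ * (geo9Y (f j)).dist a a'))) := by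
  intro j α₀ U δ _ _ _ hU hδ hδ1
  letI : Fintype (geo9K (f j).toKIdx).Site := ‹∀ x : MemberY d ℓ hd hL b₀ b₁ Mstar, Fintype (geo9Y x).Site› (f j)
  have hpc := parB_contractive G (f j) (parB j) hG1 (hparB j U hU.1.1)
  have hL1 : (1 : ℝ) ≤ 2 * (((ℓ + 1 : ℕ) : ℝ)) ^ (d + 1) := by
    have : (1 : ℝ) ≤ (((ℓ + 1 : ℕ) : ℝ)) ^ (d + 1) := one_le_pow₀ (by exact_mod_cast Nat.succ_le_succ (Nat.zero_le ℓ))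
    linarith
  have hℓ : (0 : ℝ) ≤ (ℓ : ℝ) + 3 := by positivity
  have he : Real.exp (δ * ((ℓ : ℝ) + 3)) ≤ Real.exp (1 * ((ℓ : ℝ) + 3)) := Real.exp_le_exp.2 (by nlinarith)
  have hMS : 0 ≤ M₂ * ∑ j, ‖b j‖ := hcR.le
  rw [QbQC_QY, QsbQC_QsY]
  constructor
  · refine hasMajorant_mono _ (hasMajorant_QbC (Rr := 0) (Hp := True) (f j).toKIdx (parB j) b (ιB j) (hι j) hM₂ hrepr hpc hδ.le) fun a a' => ?_
    calc M₂ * (∑ j, ‖b j‖) * (Real.exp (δ * ((ℓ : ℝ) + 3)) * Real.exp (-(δ * (geo9K (f j).toKIdx).dist a a')))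
        = M₂ * (∑ j, ‖b j‖) * 1 * Real.exp (δ * ((ℓ : ℝ) + 3)) * Real.exp (-(δ * (geo9K (f j).toKIdx).dist a a')) := by ring
      _ ≤ M₂ * (∑ j, ‖b j‖) * (2 * (((ℓ + 1 : ℕ) : ℝ)) ^ (d + 1)) * Real.exp (1 * ((ℓ : ℝ) + 3)) *
            Real.exp (-(δ * (geo9K (f j).toKIdx).dist a a')) := by gcongr
  · refine hasMajorant_mono _ (hasMajorant_QsbC (Rr := 0) (Hp := True) (f j).toKIdx (parB j) b (ιB j) (hι j) hM₂ hrepr hpc hδ.le) fun a a' => ?_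
    calc M₂ * (∑ j, ‖b j‖) * (2 * (((ℓ + 1 : ℕ) : ℝ)) ^ (d + 1) * Real.exp (δ * ((ℓ : ℝ) + 3)) * Real.exp (-(δ * (geo9K (f j).toKIdx).dist a a')))
        = M₂ * (∑ j, ‖b j‖) * (2 * (((ℓ + 1 : ℕ) : ℝ)) ^ (d + 1)) * Real.exp (δ * ((ℓ : ℝ) + 3)) * Real.exp (-(δ * (geo9K (f j).toKIdx).dist a a')) := by
          ring
      _ ≤ M₂ * (∑ j, ‖b j‖) * (2 * (((ℓ + 1 : ℕ) : ℝ)) ^ (d + 1)) * Real.exp (1 * ((ℓ : ℝ) + 3)) *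
            Real.exp (-(δ * (geo9K (f j).toKIdx).dist a a')) := by gcongr

omit [NormOneClass 𝔸] [FiniteDimensional ℝ 𝔸] instDS instNE [DecidableEq ι] in
/-- ★ **(L2) AT THE STRAIGHT PAIR**: the (3.80) variation majorants `hQ80` hold at `(QY parB, QsY parB)` with `cF := (M₂Σ‖b_j‖)·c_Var·2L^{d+1}·e^{ℓ+3}` from the
coded class's bond-transporter variation law `VarParBY parB c_Var` — `B9SectBQVariationY.hasMajorant_F₂C ∕ hasMajorant_F₂sC` through the faces `F₂QC_QY ∕ F₂sQC_QsY`.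
[cite: Balaban1985BackgroundPropagators, (3.80)–(3.81) p.406, (3.58)–(3.59) p.402; Balaban1984PropagatorsII, (2.51) p.232] -/
theorem hQ80_straight (hι : ∀ (j : J) (s : BlkY (f j).toKIdx), β (f j).toKIdx.hN (f j).toKIdx.D (f j).toKIdx.hk (ιB j s) = s)
    {M₂ : ℝ} (hM₂ : 0 ≤ M₂) (hrepr : ∀ (v : 𝔸) (j : ι), |b.repr v j| ≤ M₂ * ‖v‖) (hcR : 0 < M₂ * ∑ j, ‖b j‖)
    {cVar : ℝ} (hcVar : 0 ≤ cVar) (hvarB : ∀ j β' U a, C37 j β' U a → VarParBY (f j).toKIdx (parB j) cVar β' U a) :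
    ∀ j (β' : ℝ) (U : CfgY 𝔸 (f j).toKIdx) (a : AfldY 𝔸 (f j).toKIdx), 0 < β' → C37 j β' U a → ∀ δ : ℝ, 0 < δ → δ ≤ 1 →
      HasMajorant (g := toB6 (geo9Y (f j)) 0 True) (fun q : (Fin (d + 1) × SiteY (f j).toKIdx) × ι => blkC (f j).toKIdx (ιB j) q.1.2)
          (F₂QC (f j).toKIdx (QY (f j).toKIdx (parB j)) b (.base U) (.mult a)) (fun a₁ a₂ => ((M₂ * ∑ j, ‖b j‖) * (cVar * (2 * (((ℓ + 1 : ℕ) : ℝ)) ^ (d + 1))) * Real.exp (1 * ((ℓ : ℝ) + 3))) * β' * Real.exp (-(δ * (geo9Y (f j)).dist a₁ a₂))) ∧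
        HasMajorant (g := toB6 (geo9Y (f j)) 0 True) (fun q : (Fin (d + 1) × SiteY (f j).toKIdx) × ι => blkC (f j).toKIdx (ιB j) q.1.2)
          (F₂sQC (f j).toKIdx (QsY (f j).toKIdx (parB j)) b (.base U) (.mult a)) (fun a₁ a₂ => ((M₂ * ∑ j, ‖b j‖) * (cVar * (2 * (((ℓ + 1 : ℕ) : ℝ)) ^ (d + 1))) * Real.exp (1 * ((ℓ : ℝ) + 3))) * β' * Real.exp (-(δ * (geo9Y (f j)).dist a₁ a₂))) := by
  intro j α₁ U a hα₁ hC δ hδ hδ1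
  letI : Fintype (geo9K (f j).toKIdx).Site := ‹∀ x : MemberY d ℓ hd hL b₀ b₁ Mstar, Fintype (geo9Y x).Site› (f j)
  have hcv : 0 ≤ cVar * α₁ := mul_nonneg hcVar hα₁.le
  have hv := hvarB j α₁ U a hC
  have hℓ : (0 : ℝ) ≤ (ℓ : ℝ) + 3 := by positivity
  have he : Real.exp (δ * ((ℓ : ℝ) + 3)) ≤ Real.exp (1 * ((ℓ : ℝ) + 3)) := Real.exp_le_exp.2 (by nlinarith)
  have hL1 : (1 : ℝ) ≤ 2 * (((ℓ + 1 : ℕ) : ℝ)) ^ (d + 1) := by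
    have : (1 : ℝ) ≤ (((ℓ + 1 : ℕ) : ℝ)) ^ (d + 1) := one_le_pow₀ (by exact_mod_cast Nat.succ_le_succ (Nat.zero_le ℓ))
    linarith
  have hMS : 0 ≤ M₂ * ∑ j, ‖b j‖ := hcR.le
  rw [F₂QC_QY, F₂sQC_QsY]
  constructor
  · refine hasMajorant_mono _ (hasMajorant_F₂C (Rr := 0) (Hp := True) (f j).toKIdx (parB j) b (ιB j) (hι j) hM₂ hrepr hcv hv hδ.le) fun a a' => ?_
    calc M₂ * (∑ j, ‖b j‖) * (cVar * α₁ * Real.exp (δ * ((ℓ : ℝ) + 3)) * Real.exp (-(δ * (geo9K (f j).toKIdx).dist a a')))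
        = M₂ * (∑ j, ‖b j‖) * (cVar * 1) * Real.exp (δ * ((ℓ : ℝ) + 3)) * α₁ * Real.exp (-(δ * (geo9K (f j).toKIdx).dist a a')) := by ring
      _ ≤ M₂ * (∑ j, ‖b j‖) * (cVar * (2 * (((ℓ + 1 : ℕ) : ℝ)) ^ (d + 1))) * Real.exp (1 * ((ℓ : ℝ) + 3)) * α₁ *
            Real.exp (-(δ * (geo9K (f j).toKIdx).dist a a')) := by gcongr
  · refine hasMajorant_mono _ (hasMajorant_F₂sC (Rr := 0) (Hp := True) (f j).toKIdx (parB j) b (ιB j) (hι j) hM₂ hrepr hcv hv hδ.le) fun a a' => ?_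
    calc M₂ * (∑ j, ‖b j‖) * (cVar * α₁ * (2 * (((ℓ + 1 : ℕ) : ℝ)) ^ (d + 1)) * Real.exp (δ * ((ℓ : ℝ) + 3)) *
          Real.exp (-(δ * (geo9K (f j).toKIdx).dist a a')))
        = M₂ * (∑ j, ‖b j‖) * (cVar * (2 * (((ℓ + 1 : ℕ) : ℝ)) ^ (d + 1))) * Real.exp (δ * ((ℓ : ℝ) + 3)) * α₁ *
            Real.exp (-(δ * (geo9K (f j).toKIdx).dist a a')) := by ring
      _ ≤ M₂ * (∑ j, ‖b j‖) * (cVar * (2 * (((ℓ + 1 : ℕ) : ℝ)) ^ (d + 1))) * Real.exp (1 * ((ℓ : ℝ) + 3)) * α₁ *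
            Real.exp (-(δ * (geo9K (f j).toKIdx).dist a a')) := by gcongr

omit [NormOneClass 𝔸] [FiniteDimensional ℝ 𝔸] instNE [DecidableEq ι] in
/-- ★ **(L3) AT THE STRAIGHT PAIR, sizes**: the block-ℓ² majorants `hQL2` of `l2GFrame₈CodedOnSelQ` hold at `(QY parB, QsY parB)` with
`κQ2 := (√|ι|·M₂Σ‖b_j‖)·√(2L^{d+1})·e^{ℓ+3}` — `B9SectBQLettersL2Y.hasL2Majorant_QbC2 ∕ hasL2Majorant_QsbC2` through `QbQC2_QY ∕ QsbQC2_QsY`.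
[cite: Balaban1985BackgroundPropagators, (3.15) p.393, (3.46) p.398; Balaban1984PropagatorsII, Prop. 2.6 (2.140) p.247] -/
theorem hQL2_straight (hι : ∀ (j : J) (s : BlkY (f j).toKIdx), β (f j).toKIdx.hN (f j).toKIdx.D (f j).toKIdx.hk (ιB j s) = s)
    (hG1 : ∀ u : 𝔸ˣ, u ∈ G → ‖(u : 𝔸)‖ ≤ 1) {M₂ : ℝ} (hM₂ : 0 ≤ M₂) (hrepr : ∀ (v : 𝔸) (j : ι), |b.repr v j| ≤ M₂ * ‖v‖)
    (hparB : ∀ j (U : CfgY 𝔸 (f j).toKIdx), GVal G (f j).toKIdx U → ∀ y f', parB j U y f' ∈ G) (MInv aInv : ℝ) :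
    ∀ j (α₀ : ℝ) (U : CfgY 𝔸 (f j).toKIdx) (δ : ℝ), MInv ≤ (geo9Y (f j)).M → 0 < α₀ → (geo9Y (f j)).M * α₀ ≤ aInv →
      (bg9YC 𝔸 G P (f j)).Reg335 c35 α₀ U → 0 < δ → δ ≤ 1 →
      HasL2Majorant (g := toB6 (geo9Y (f j)) 0 True) (fun q : (Fin (d + 1) × SiteY (f j).toKIdx) × ι => blkC (f j).toKIdx (ιB j) q.1.2)
          (QbQC2 (f j).toKIdx (QY (f j).toKIdx (parB j)) b (.base U)) (fun a a' => ((Real.sqrt (Fintype.card ι) * M₂ * ∑ j, ‖b j‖) * (1 * Real.sqrt (2 * (((ℓ + 1 : ℕ) : ℝ)) ^ (d + 1))) * Real.exp (1 * ((ℓ : ℝ) + 3))) * Real.exp (-(δ * (geo9Y (f j)).dist a a'))) ∧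
        HasL2Majorant (g := toB6 (geo9Y (f j)) 0 True) (fun q : (Fin (d + 1) × SiteY (f j).toKIdx) × ι => blkC (f j).toKIdx (ιB j) q.1.2)
          (QsbQC2 (f j).toKIdx (QsY (f j).toKIdx (parB j)) b (.base U)) (fun a a' => ((Real.sqrt (Fintype.card ι) * M₂ * ∑ j, ‖b j‖) * (1 * Real.sqrt (2 * (((ℓ + 1 : ℕ) : ℝ)) ^ (d + 1))) * Real.exp (1 * ((ℓ : ℝ) + 3))) * Real.exp (-(δ * (geo9Y (f j)).dist a a'))) := by
  intro j α₀ U δ _ _ _ hU hδ hδc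
  letI : Fintype (geo9K (f j).toKIdx).Site := ‹∀ x : MemberY d ℓ hd hL b₀ b₁ Mstar, Fintype (geo9Y x).Site› (f j)
  letI : DecidableEq (geo9K (f j).toKIdx).Site := instDS (f j)
  have hpc := parB_contractive G (f j) (parB j) hG1 (hparB j U hU.1.1)
  have hℓ : (0 : ℝ) ≤ (ℓ : ℝ) + 3 := by positivity
  have he : Real.exp (δ * ((ℓ : ℝ) + 3)) ≤ Real.exp (1 * ((ℓ : ℝ) + 3)) := Real.exp_le_exp.2 (by nlinarith)
  rw [QbQC2_QY, QsbQC2_QsY]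
  constructor
  · refine hasL2Majorant_mono _ (hasL2Majorant_QbC2 (Rr := 0) (Hp := True) (f j).toKIdx (parB j) b (ιB j) (hι j) hM₂ hrepr hpc hδ.le) fun a a' => ?_
    calc (Real.sqrt (Fintype.card ι) * M₂ * ∑ j, ‖b j‖) * (1 * Real.sqrt (2 * (((ℓ + 1 : ℕ) : ℝ)) ^ (d + 1)) *
          (Real.exp (δ * ((ℓ : ℝ) + 3)) * Real.exp (-(δ * (geo9K (f j).toKIdx).dist a a'))))
        = (Real.sqrt (Fintype.card ι) * M₂ * ∑ j, ‖b j‖) * (1 * Real.sqrt (2 * (((ℓ + 1 : ℕ) : ℝ)) ^ (d + 1))) *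
            Real.exp (δ * ((ℓ : ℝ) + 3)) * Real.exp (-(δ * (geo9K (f j).toKIdx).dist a a')) := by ring
      _ ≤ (Real.sqrt (Fintype.card ι) * M₂ * ∑ j, ‖b j‖) * (1 * Real.sqrt (2 * (((ℓ + 1 : ℕ) : ℝ)) ^ (d + 1))) *
            Real.exp (1 * ((ℓ : ℝ) + 3)) * Real.exp (-(δ * (geo9K (f j).toKIdx).dist a a')) := by gcongr
  · refine hasL2Majorant_mono _ (hasL2Majorant_QsbC2 (Rr := 0) (Hp := True) (f j).toKIdx (parB j) b (ιB j) (hι j) hM₂ hrepr hpc hδ.le) fun a a' => ?_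
    calc (Real.sqrt (Fintype.card ι) * M₂ * ∑ j, ‖b j‖) * (1 * Real.sqrt (2 * (((ℓ + 1 : ℕ) : ℝ)) ^ (d + 1)) *
          (Real.exp (δ * ((ℓ : ℝ) + 3)) * Real.exp (-(δ * (geo9K (f j).toKIdx).dist a a'))))
        = (Real.sqrt (Fintype.card ι) * M₂ * ∑ j, ‖b j‖) * (1 * Real.sqrt (2 * (((ℓ + 1 : ℕ) : ℝ)) ^ (d + 1))) *
            Real.exp (δ * ((ℓ : ℝ) + 3)) * Real.exp (-(δ * (geo9K (f j).toKIdx).dist a a')) := by ring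
      _ ≤ (Real.sqrt (Fintype.card ι) * M₂ * ∑ j, ‖b j‖) * (1 * Real.sqrt (2 * (((ℓ + 1 : ℕ) : ℝ)) ^ (d + 1))) *
            Real.exp (1 * ((ℓ : ℝ) + 3)) * Real.exp (-(δ * (geo9K (f j).toKIdx).dist a a')) := by gcongr

omit [NormOneClass 𝔸] [FiniteDimensional ℝ 𝔸] instNE [DecidableEq ι] in
/-- ★ **(L3) AT THE STRAIGHT PAIR, variations**: the block-ℓ² (3.80) majorants `hQL280` hold at `(QY parB, QsY parB)` with
`cF2 := (√|ι|·M₂Σ‖b_j‖)·c_Var·√(2L^{d+1})·e^{ℓ+3}` — `B9SectBQLettersL2Y.hasL2Majorant_F₂C2 ∕ hasL2Majorant_F₂sC2` through `F₂QC2_QY ∕ F₂sQC2_QsY`.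
[cite: Balaban1985BackgroundPropagators, (3.80)–(3.81) p.406, (3.46) p.398; Balaban1984PropagatorsII, Prop. 2.6 (2.140) p.247] -/
theorem hQL280_straight (hι : ∀ (j : J) (s : BlkY (f j).toKIdx), β (f j).toKIdx.hN (f j).toKIdx.D (f j).toKIdx.hk (ιB j s) = s)
    {M₂ : ℝ} (hM₂ : 0 ≤ M₂) (hrepr : ∀ (v : 𝔸) (j : ι), |b.repr v j| ≤ M₂ * ‖v‖)
    {cVar : ℝ} (hcVar : 0 ≤ cVar) (hvarB : ∀ j β' U a, C37 j β' U a → VarParBY (f j).toKIdx (parB j) cVar β' U a) :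
    ∀ j (β' : ℝ) (U : CfgY 𝔸 (f j).toKIdx) (a : AfldY 𝔸 (f j).toKIdx), 0 < β' → C37 j β' U a → ∀ δ : ℝ, 0 < δ → δ ≤ 1 →
      HasL2Majorant (g := toB6 (geo9Y (f j)) 0 True) (fun q : (Fin (d + 1) × SiteY (f j).toKIdx) × ι => blkC (f j).toKIdx (ιB j) q.1.2)
          (F₂QC2 (f j).toKIdx (QY (f j).toKIdx (parB j)) b (.base U) (.mult a)) (fun a₁ a₂ => ((Real.sqrt (Fintype.card ι) * M₂ * ∑ j, ‖b j‖) * (cVar * Real.sqrt (2 * (((ℓ + 1 : ℕ) : ℝ)) ^ (d + 1))) * Real.exp (1 * ((ℓ : ℝ) + 3))) * β' * Real.exp (-(δ * (geo9Y (f j)).dist a₁ a₂))) ∧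
        HasL2Majorant (g := toB6 (geo9Y (f j)) 0 True) (fun q : (Fin (d + 1) × SiteY (f j).toKIdx) × ι => blkC (f j).toKIdx (ιB j) q.1.2)
          (F₂sQC2 (f j).toKIdx (QsY (f j).toKIdx (parB j)) b (.base U) (.mult a)) (fun a₁ a₂ => ((Real.sqrt (Fintype.card ι) * M₂ * ∑ j, ‖b j‖) * (cVar * Real.sqrt (2 * (((ℓ + 1 : ℕ) : ℝ)) ^ (d + 1))) * Real.exp (1 * ((ℓ : ℝ) + 3))) * β' * Real.exp (-(δ * (geo9Y (f j)).dist a₁ a₂))) := by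
  intro j α₁ U a hα₁ hC δ hδ hδc
  letI : Fintype (geo9K (f j).toKIdx).Site := ‹∀ x : MemberY d ℓ hd hL b₀ b₁ Mstar, Fintype (geo9Y x).Site› (f j)
  letI : DecidableEq (geo9K (f j).toKIdx).Site := instDS (f j)
  have hcv : 0 ≤ cVar * α₁ := mul_nonneg hcVar hα₁.le
  have hv := hvarB j α₁ U a hC
  have hℓ : (0 : ℝ) ≤ (ℓ : ℝ) + 3 := by positivity
  have he : Real.exp (δ * ((ℓ : ℝ) + 3)) ≤ Real.exp (1 * ((ℓ : ℝ) + 3)) := Real.exp_le_exp.2 (by nlinarith)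
  rw [F₂QC2_QY, F₂sQC2_QsY]
  constructor
  · refine hasL2Majorant_mono _ (hasL2Majorant_F₂C2 (Rr := 0) (Hp := True) (f j).toKIdx (parB j) b (ιB j) (hι j) hM₂ hrepr hcv hv hδ.le)
      fun a' a'' => ?_
    calc (Real.sqrt (Fintype.card ι) * M₂ * ∑ j, ‖b j‖) * (cVar * α₁ * Real.sqrt (2 * (((ℓ + 1 : ℕ) : ℝ)) ^ (d + 1)) *
          (Real.exp (δ * ((ℓ : ℝ) + 3)) * Real.exp (-(δ * (geo9K (f j).toKIdx).dist a' a''))))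
        = (Real.sqrt (Fintype.card ι) * M₂ * ∑ j, ‖b j‖) * (cVar * Real.sqrt (2 * (((ℓ + 1 : ℕ) : ℝ)) ^ (d + 1))) *
            Real.exp (δ * ((ℓ : ℝ) + 3)) * α₁ * Real.exp (-(δ * (geo9K (f j).toKIdx).dist a' a'')) := by ring
      _ ≤ (Real.sqrt (Fintype.card ι) * M₂ * ∑ j, ‖b j‖) * (cVar * Real.sqrt (2 * (((ℓ + 1 : ℕ) : ℝ)) ^ (d + 1))) *
            Real.exp (1 * ((ℓ : ℝ) + 3)) * α₁ * Real.exp (-(δ * (geo9K (f j).toKIdx).dist a' a'')) := by gcongr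
  · refine hasL2Majorant_mono _ (hasL2Majorant_F₂sC2 (Rr := 0) (Hp := True) (f j).toKIdx (parB j) b (ιB j) (hι j) hM₂ hrepr hcv hv hδ.le)
      fun a' a'' => ?_
    calc (Real.sqrt (Fintype.card ι) * M₂ * ∑ j, ‖b j‖) * (cVar * α₁ * Real.sqrt (2 * (((ℓ + 1 : ℕ) : ℝ)) ^ (d + 1)) *
          (Real.exp (δ * ((ℓ : ℝ) + 3)) * Real.exp (-(δ * (geo9K (f j).toKIdx).dist a' a''))))
        = (Real.sqrt (Fintype.card ι) * M₂ * ∑ j, ‖b j‖) * (cVar * Real.sqrt (2 * (((ℓ + 1 : ℕ) : ℝ)) ^ (d + 1))) *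
            Real.exp (δ * ((ℓ : ℝ) + 3)) * α₁ * Real.exp (-(δ * (geo9K (f j).toKIdx).dist a' a'')) := by ring
      _ ≤ (Real.sqrt (Fintype.card ι) * M₂ * ∑ j, ‖b j‖) * (cVar * Real.sqrt (2 * (((ℓ + 1 : ℕ) : ℝ)) ^ (d + 1))) *
            Real.exp (1 * ((ℓ : ℝ) + 3)) * α₁ * Real.exp (-(δ * (geo9K (f j).toKIdx).dist a' a'')) := by gcongr


variable (C38 : ∀ j : J, ℝ → CfgY 𝔸 (f j).toKIdx → AfldY 𝔸 (f j).toKIdx → Prop) (parA parH : ∀ j : J, SiteParY 𝔸 (f j).toKIdx)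

/-! ## §2 ★★ SUBSUMPTION: S5's straight junction from the K2-G junction -/

/-- ★★ **SUBSUMPTION — S5's straight junction IS the K2-G junction at `(𝔮, 𝔮s) := (QY parBY, QsY parBY)`**: `B9SectBStepUParGOfMembers.sectBStepUParG_of_members`'
statement VERBATIM (same binders, same conclusion `SectBStepUPar … (fun j => GAY _ (parA j) (parBY _) (GpY _ (parA j))) …`), re-derived from
`sectBStepUParGQ_of_members` with the displayed Q-laws discharged by §1 (`hparB := hparB_parBY`) — the faces `GAQY_QY ∕ deltaAQY_QY` are `rfl`, so `hunitA`, `h33`,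
`h261` and the conclusion are accepted definitionally.  (node00-def-Y ruling I.20106 (a): «straight = instance by rfl, nothing landed re-proved».)  Stated as an
`example` (an in-tree kernel check, not a declaration: the statement IS the landed `sectBStepUParG_of_members`, which the dedup gate rightly refuses to re-declare).
[cite: Balaban1985BackgroundPropagators, Thm 3.4 p.400, Sect. B p.407, Thm 3.3 p.399, (3.27) p.395, (3.15) p.393, (3.80) p.406] -/
example (hι : ∀ (j : J) (s : BlkY (f j).toKIdx), β (f j).toKIdx.hN (f j).toKIdx.D (f j).toKIdx.hk (ιB j s) = s)
    (hG1 : ∀ u : 𝔸ˣ, u ∈ G → ‖(u : 𝔸)‖ ≤ 1)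
    (hparH : ∀ j (U : CfgY 𝔸 (f j).toKIdx), GVal G (f j).toKIdx U → ∀ z w, parH j U z w ∈ G)
    (M₂ : ℝ) (hM₂ : 0 ≤ M₂) (hrepr : ∀ (v : 𝔸) (j : ι), |b.repr v j| ≤ M₂ * ‖v‖) (hcR : 0 < M₂ * ∑ j, ‖b j‖)
    (hcL : 0 < Real.sqrt (Fintype.card ι) * M₂ * ∑ j, ‖b j‖)
    (Cq : ℝ) (hCq : 0 ≤ Cq)
    (hC37 : ∀ j β' U a, C37 j β' U a → GVal G (f j).toKIdx U ∧ CplxLettersY G (f j) (parA j) (ιB j) Cq β' U a)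
    (MInv aInv aW : ℝ) (hMInv : 0 < MInv) (haInv : 0 < aInv) (haW : 0 < aW)
    (hparG : ∀ j (α₀ : ℝ) (U : CfgY 𝔸 (f j).toKIdx), MInv ≤ (geo9Y (f j)).M → 0 < α₀ → (geo9Y (f j)).M * α₀ ≤ aInv →
      (bg9YC 𝔸 G P (f j)).Reg335 c35 α₀ U → ∀ z w, parA j U z w ∈ G)
    (hparC : ∀ j β' U a, C37 j β' U a → ∀ z w, parA j U z w ∈ G)
    (hunitG : ∀ j (α₀ : ℝ) (U : CfgY 𝔸 (f j).toKIdx), MInv ≤ (geo9Y (f j)).M → 0 < α₀ → (geo9Y (f j)).M * α₀ ≤ aInv →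
      (bg9YC 𝔸 G P (f j)).Reg335 c35 α₀ U → IsUnit (deltaPrimeAY (f j).toKIdx (parA j) U))
    (hunitXG : ∀ j (α₀ : ℝ) (U : CfgY 𝔸 (f j).toKIdx), MInv ≤ (geo9Y (f j)).M → 0 < α₀ → (geo9Y (f j)).M * α₀ ≤ aInv →
      (bg9YC 𝔸 G P (f j)).Reg335 c35 α₀ U → IsUnit (XY (f j).toKIdx (parA j) (GpY (f j).toKIdx (parA j)) U))
    (hsym : ∀ j (U : CfgY 𝔸 (f j).toKIdx) (z w : SiteY (f j).toKIdx), parA j U z w = (parA j U w z)⁻¹)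
    (hunitA : ∀ j (α₀ : ℝ) (U : CfgY 𝔸 (f j).toKIdx), MInv ≤ (geo9Y (f j)).M → 0 < α₀ → (geo9Y (f j)).M * α₀ ≤ aInv →
      (bg9YC 𝔸 G P (f j)).Reg335 c35 α₀ U → IsUnit (deltaAY (f j).toKIdx (parA j) (parBY (f j).toKIdx) (GpY (f j).toKIdx (parA j)) U)) (hb₁ : 0 ≤ b₁)
    (C₀ : ℝ) (hC₀ : 0 ≤ C₀)
    (hreg335P : ∀ j (α₀ : ℝ) (U : CfgY 𝔸 (f j).toKIdx), MInv ≤ (geo9Y (f j)).M → 0 < α₀ → (geo9Y (f j)).M * α₀ ≤ aInv →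
      (bg9YC 𝔸 G P (f j)).Reg335 c35 α₀ U → Reg335PlaqY G (f j) (ιB j) C₀ U)
    (hC37G : ∀ j β' U a, C37 j β' U a → CplxLettersGY G (f j) (ιB j) β' U a)
    (cVar : ℝ) (hcVar : 0 ≤ cVar) (hvarB : ∀ j β' U a, C37 j β' U a → VarParBY (f j).toKIdx (parBY (f j).toKIdx) cVar β' U a)
    (hMd : 2 * ((d : ℝ) + 1) < MInv) (mN : ℕ) (hnbr : ∀ (j : J) (y' : IBondY (f j).toKIdx), (nbr (geo9Y (f j)) (2 * ((d : ℝ) + 1)) y').card ≤ mN)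
    (hMr : rLB d ℓ + 1 < MInv)
    {cLip : ℝ} (hcLip : 0 ≤ cLip)
    (hLip : ∀ (j : J) (α₀ : ℝ) (U : CfgY 𝔸 (f j).toKIdx), (bg9YC 𝔸 G P (f j)).Reg335 c35 α₀ U → HolderLipY (f j).toKIdx cLip (parH j U) U)
    {cP : ℝ} (hcP : 0 ≤ cP)
    (hplaq : ∀ (j : J) (α₀ : ℝ) (U : CfgY 𝔸 (f j).toKIdx), MInv ≤ (geo9Y (f j)).M → 0 < α₀ → (geo9Y (f j)).M * α₀ ≤ aInv →
      (bg9YC 𝔸 G P (f j)).Reg335 c35 α₀ U → PlaqLawY (f j) (ιB j) cP U)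
    (d261 : ℝ → ℕ)
    (h261 : ∀ (j : J) (δ α : ℝ), 0 < δ → δ ≤ 1 → 9 / 5000 ≤ α → α < 1 →
      (gFrame₅CodedOnSel P f c35 G parA (fun j => parBY (f j).toKIdx) b ιB C37 C38 hι hG1 M₂ hM₂ hrepr hcR Cq hCq hC37 MInv aInv aW hMInv haInv haW hparG hparC hunitG
        hunitXG hsym hunitA (hparB_parBY f G) hb₁ C₀ hC₀ hreg335P hC37G cVar hcVar hvarB hMd mN hnbr).M261 δ ≤ (geo9Y (f j)).M →
      Ineq261 (d261 δ) (toB6 (geo9Y (f j)) 0 True) δ α)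
    (h32 : B9.Thm32Printed (d + 1) c35 (fun j => geo9Y (f j)) (fun j => bg9YC 𝔸 G P (f j)) (CinvY P f G parA))
    (h33 : B9.Thm33Printed c35 (fun j => geo9Y (f j)) (fun j => (codingYx P G (f j) (C37 j) (C38 j)).bg)
      (fun j => KSCUPar P G (f j) (parA j) (parH j) (C37 j) (C38 j))
      (fun j => KACU P G (f j) (GAY (f j).toKIdx (parA j) (parBY (f j).toKIdx) (GpY (f j).toKIdx (parA j))) (parBY (f j).toKIdx) (C37 j) (C38 j))) :
    SectBStepUPar P f (d + 1) c35 G b parA parH (fun j => GAY (f j).toKIdx (parA j) (parBY (f j).toKIdx) (GpY (f j).toKIdx (parA j))) (fun j => parBY (f j).toKIdx)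
      C37 C38 (CinvY P f G parA) := by
  exact sectBStepUParGQ_of_members P f c35 G (fun j => QY (f j).toKIdx (parBY (f j).toKIdx)) (fun j => QsY (f j).toKIdx (parBY (f j).toKIdx)) b ιB C38 parA parH
    C37 hι hG1 hparH M₂ hM₂ hrepr hcR hcL Cq hCq hC37 MInv aInv aW hMInv haInv haW hparG hparC hunitG hunitXG hsym hunitA hb₁ C₀ hC₀ hreg335P hC37G
    _ (by positivity) (hQ15_straight P f c35 G (fun j => parBY (f j).toKIdx) b ιB hι hG1 hM₂ hrepr hcR (hparB_parBY f G) MInv aInv)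
    _ (by positivity) (hQ80_straight f (fun j => parBY (f j).toKIdx) b ιB C37 hι hM₂ hrepr hcR hcVar hvarB)
    _ (by positivity) (hQL2_straight P f c35 G (fun j => parBY (f j).toKIdx) b ιB hι hG1 hM₂ hrepr (hparB_parBY f G) MInv aInv)
    _ (by positivity) (hQL280_straight f (fun j => parBY (f j).toKIdx) b ιB C37 hι hM₂ hrepr hcVar hvarB)
    hMd mN hnbr hMr hcLip hLip hcP hplaq d261 h261 h32 h33

end Literature.MathematicalPhysics.QuantumFieldTheory.Balaban1983to89.B9SectBQLawsStraightY

end
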